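import Mathlib
import HarnessLib
import HarnessLib.Audit
import Summits.PneNP.PneNP.Theses.SymmetryBudget
import Literature.Computability.Complexity.SymmetricCircuit
import Literature.Computability.Complexity.GraphCanonization
import Summits.PneNP.PneNP.Theorems.SymmetryBudgetWindowBarrierStubTwinIsoHardOfCoreFooling
import Summits.PneNP.PneNP.Theorems.SymmetryBudgetWindowBarrierStubTwinIsoInP
import Summits.PneNP.PneNP.Theorems.SymmetryBudgetWindowBarrierHardToIdentifyBridge

/-!
# Line `bijection-gauge-twin-iso` — crux `SymmetryBudget.WindowBarrier` (stmt-PneNP-2145)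

Crux (fixed; route `route-PneNP-SymmetryBudget`, rank 4): there is `L ∈ P` whose graph slices
`x ↦ [encode ⟨m, Gr x⟩ ∈ L]` are `Bud(m,⌊log₂ m⌋)`-invariant and, for every polynomial `p`, infinitely
often have no `Bud(m,⌊log₂ m⌋)`-symmetric threshold circuit of size `≤ p m`.

Idea (crux idea card `Ideas/bijection-gauge-twin-iso.md`; triage r1: k2 pass (narrow), k3 fail —
built here in the RESHAPED form the panel asked for): the witness language is TWIN ISOMORPHISM.
Split the `g = ⌊log₂ m⌋` free vertices of an `m`-vertex graph `G` into the ones adjacent to the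
ORDERED marker vertex `0` (`A`) and the others (`B`) and ask whether `G[A] ≅ G[B]`. This property is
`Bud`-invariant (a budget permutation fixes `0`, permutes the free part and is itself an isomorphism
of the relabelled graph — PROVED below, `twinIso_relabel_iff`), it is in `P` because graph
isomorphism of two `≤ log₂ m`-vertex graphs costs `2^{O(√(g log g))} = m^{o(1)}` (Babai–Luks 1983,
the tree's named fact `babaiLuks1983_canonicalForm`; brute force `(g/2)!` would NOT be polynomial),
and its only known symmetric circuits enumerate the `(g/2)!` bijections between the halves — the
hidden datum is an EXISTENTIAL bijection, never materialised in the input, so the subset-indexed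
brute force that kills CFI-type witnesses at this scale (orbits `≤ 2^g ≤ m`) has nothing to guess.

Capstone (kernel-checked here): `WindowBarrier ⟸ babaiLuks1983_canonicalForm ∧ TwinIsoHard`
(`windowBarrier_of_twinIso`, `WindowBarrier_of`), where

  TwinIsoHard (`stub_twinIsoHard`, the OPEN stub): for every polynomial `p`, infinitely often NO
  `Bud(m,⌊log₂ m⌋)`-symmetric `tcBasis`-circuit of size `≤ p m` computes `x ↦ [Gr x [A] ≅ Gr x [B]]`.

TwinIsoHard is an EXPLICIT-FUNCTION lower bound; it is implied by the picked line's open core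
(★) CoreFooling (one pair of non-isomorphic `h`-vertex graphs fooling every `Sym(h)`-symmetric
threshold circuit of size `2^{dh}`) through a relocation argument (`stub_twinIsoHard_of_coreFooling`,
provable now with the landed `CoreReduction`/`Relocation` calculus: plant `G₁` on `A`, the live graph
on `B`, marker edges from `0` to `A`, zeros elsewhere), and it is possibly STRICTLY WEAKER than (★)
(circuit-dependent counterexamples suffice). So the line offers the crux a second, weaker open core,
and every (★)-witness closes it as well (`windowBarrier_restated_of_coreFooling`).

Status (lead prover-line-stmt-PneNP-2145-0, gen 1, cycle 1): S_T LANDED (p85069,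
`Theorems/SymmetryBudgetWindowBarrierStubTwinIsoHardOfCoreFooling.lean`, wired below); S_BL = literature debt
(worker verdict `stub-blocked: babaiLuks1983_canonicalForm`; no canoniser in tree or stockroom, Corneil–Goldberg
formalisation ≈ 5–7k lines); S_P LANDED (p89186, `Theorems/SymmetryBudgetWindowBarrierStubTwinIsoInP.lean`, bricks p85656/p85700, wired below); S_H RESHAPED to its sufficient core HardToIdentify (`stub_hardToIdentify`, the only open stub besides
the literature debt; `stub_twinIsoHard` is derived from it by the landed bridge p86449) — analysed in
`Lines/bijection-gauge-twin-iso-S_H.md`: the tree now has the chain (★) ⟹ HardToIdentify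
(`Theorems/SymmetryBudgetWindowBarrierHardToIdentify.lean`, p84987) ⟹ TwinIsoHard (bridge file prepared), and S_H is
equivalent, modulo compilations, to the existence of a set-robust non-gadget source of near-linear Weisfeiler–Leman
dimension (¬TAME_Q) — crux-sized.

Stubs (registered by `ledger skeleton check`; every statement is self-contained over tree decls):
* `stub_canonicalFormFTIME` — Babai–Luks 1983 canonical forms, VERBATIM the body of the named fact
  `babaiLuks1983_canonicalForm` and verbatim the picked line's S1a (one shared literature debt, XL).
* `stub_twinIsoInP_of_canonicalForm` — canonical forms ⇒ the twin-isomorphism language is in `P`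
  (provable now: FP extraction of the two marked halves + `2^{O(√N)}` on `O(log² m)`-bit codes; L).
* `stub_twinIsoHard` — the OPEN core of this line (explicit-function symmetric lower bound in the window).
* `stub_twinIsoHard_of_coreFooling` — (★) ⇒ TwinIsoHard (provable now, relocation with constants; M);
  its hypothesis (★) is VERBATIM the hypothesis of the landed `Theorems.stub_coreReduction` (the picked
  line's open core, proposed for promotion to an item in `Lines/canonical-form-completeness-PROMOTE.md`)
  and is deliberately NOT re-registered as a stub of this line.

Composition (no `sorry`): `twinIso_relabel_iff` (Bud-invariance of twin isomorphism, all `m`),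
`windowBarrier_of_twinIso : TwinIsoInP → TwinIsoHard → (crux over the landed vocabulary)`,
`WindowBarrier_of : …SymmetryBudget.WindowBarrier` (by name; the route's inline `Sym/HasSym/Bud/Gr`
are definitionally `Circuit.IsSymmetricUnder` / `HasSymCircuit tcBasis` / `pointStabiliserBudget` /
`SimpleGraph.fromRel`), and the recorded (★)-sub-route `windowBarrier_restated_of_coreFooling :
(★) → (crux restated)` — a hypothesis-taking theorem, so that `WindowBarrier_of` is the ONLY theorem of
the file concluding the crux by name. No new definitions (statements are inlined; `relabelIso` is the
one auxiliary `def`, a graph isomorphism used inside a proof).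

Disproof.lean findings honoured: F3 (invariance load-bearing) — discharged by PROOF, not by a stub
(`twinIso_relabel_iff`); F3′/`not_windowBarrierAt_zero` (symmetry load-bearing) — the `Bud`-symmetry
hypothesis sits inside `HasSymCircuit` in `stub_twinIsoHard`, and at budget `0`/`g! ≤ poly` the stub is
false exactly as the crux is; F12 (`SymCanonisation ⇒ ¬WindowBarrier`) is this line's falsifier too
(symmetric canonisation of the halves decides twin isomorphism); T0–T3 (`Fools.*`) constrain fooling
PAIRS, i.e. the (★)-sub-route, not the function form. No landed `Negative/*` lemma refutes any stub
(BudgetZero / InvarianceAndBridge concern budget `0` and non-invariant slices).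
-/

-- `Summit.PneNP.PneNP.…` duplicates `PneNP` BY DESIGN (single-problem summit, D-0017).
set_option linter.dupNamespace false

namespace Summit.PneNP.PneNP.Cruxes.WindowBarrier.BijectionGaugeTwinIso

open Literature.Computability.Complexity Filter
open scoped Classical

/-! ## The stubs -/

/-- **S_BL — canonical forms of vertex-coloured graphs in moderately exponential time
(Babai–Luks 1983; KNOWN theorem, literature debt; shared VERBATIM with line
`canonical-form-completeness`, stub S1a).** The body of the tree's named fact
`Literature.Computability.Complexity.babaiLuks1983_canonicalForm` (landed p74928,
`GraphCanonization.lean`; `stub_canonicalFormFTIME_iff` below is `Iff.rfl`): there are `c` and a string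
map `can ∈ FTIME(N ↦ 2^{c√N})` which on the code of a vertex-coloured graph on `Fin k` returns the code
of a colour-isomorphic coloured graph and takes equal values on codes of colour-isomorphic coloured
graphs. Discharged only by formalising such a canoniser (XL; Corneil–Goldberg's combinatorial `c^k`
canoniser would do). Why here: it puts twin isomorphism in `P` at scale `log m` WITHOUT brute force
(`(g/2)! = m^{Θ(log log m)}` is superpolynomial; shrinking the halves until `h! ≤ poly(m)` would make the
function symmetric-cheap by symmetrisation — the window's arithmetic forces a genuine GI algorithm).
Size: XL (literature debt; known theorem). Source: Babai–Luks, STOC 1983, doi:10.1145/800061.808746,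
Abstract and §4; arXiv:1512.03547 (Babai 2016, implies it). -/
theorem stub_canonicalFormFTIME :
    ∃ c : ℕ, ∃ can ∈ FTIME (fun N => 2 ^ (c * Nat.sqrt N)),
      (∀ (k : ℕ) (G : SimpleGraph (Fin k)) (col : Fin k → ℕ),
          ∃ (G' : SimpleGraph (Fin k)) (col' : Fin k → ℕ),
            can (boolPair (encodingGraph.encode ⟨k, G⟩)
                  ((encodingFinVec Computability.encodingNatBool k).encode col)) =
                boolPair (encodingGraph.encode ⟨k, G'⟩)
                  ((encodingFinVec Computability.encodingNatBool k).encode col') ∧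
              ∃ σ : G ≃g G', ∀ v : Fin k, col' (σ v) = col v) ∧
      ∀ (k : ℕ) (G₁ : SimpleGraph (Fin k)) (c₁ : Fin k → ℕ) (G₂ : SimpleGraph (Fin k))
        (c₂ : Fin k → ℕ), (∃ σ : G₁ ≃g G₂, ∀ v : Fin k, c₂ (σ v) = c₁ v) →
          can (boolPair (encodingGraph.encode ⟨k, G₁⟩)
                ((encodingFinVec Computability.encodingNatBool k).encode c₁)) =
            can (boolPair (encodingGraph.encode ⟨k, G₂⟩)
                ((encodingFinVec Computability.encodingNatBool k).encode c₂)) := by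
  -- LITERATURE DEBT: `exact babaiLuks1983_canonicalForm_holds` once the named fact is discharged.
  sorry

/-- S_BL is the tree's named fact `babaiLuks1983_canonicalForm`, definitionally. -/
theorem stub_canonicalFormFTIME_iff :
    babaiLuks1983_canonicalForm ↔
    ∃ c : ℕ, ∃ can ∈ FTIME (fun N => 2 ^ (c * Nat.sqrt N)),
      (∀ (k : ℕ) (G : SimpleGraph (Fin k)) (col : Fin k → ℕ),
          ∃ (G' : SimpleGraph (Fin k)) (col' : Fin k → ℕ),
            can (boolPair (encodingGraph.encode ⟨k, G⟩)
                  ((encodingFinVec Computability.encodingNatBool k).encode col)) =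
                boolPair (encodingGraph.encode ⟨k, G'⟩)
                  ((encodingFinVec Computability.encodingNatBool k).encode col') ∧
              ∃ σ : G ≃g G', ∀ v : Fin k, col' (σ v) = col v) ∧
      ∀ (k : ℕ) (G₁ : SimpleGraph (Fin k)) (c₁ : Fin k → ℕ) (G₂ : SimpleGraph (Fin k))
        (c₂ : Fin k → ℕ), (∃ σ : G₁ ≃g G₂, ∀ v : Fin k, c₂ (σ v) = c₁ v) →
          can (boolPair (encodingGraph.encode ⟨k, G₁⟩)
                ((encodingFinVec Computability.encodingNatBool k).encode c₁)) =
            can (boolPair (encodingGraph.encode ⟨k, G₂⟩)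
                ((encodingFinVec Computability.encodingNatBool k).encode c₂)) :=
  Iff.rfl

/-- **S_P — twin isomorphism is polynomial time, given canonical forms (provable now; L).**
From `can` as in S_BL build `L := {w | w = encode ⟨m, G⟩ for some m, G with TwinIso m G}` and show
`L ∈ Classes.P`, where `TwinIso m G` says: with `g = ⌊log₂ m⌋`, `F = {u | m ≤ u + g}` the free
vertices, `A = {u ∈ F | G.Adj 0 u}` and `B = F ∖ A`, the induced subgraphs `G[A]` and `G[B]` are
isomorphic. Decision procedure: decode `w` (reject non-codes: `encodingGraph` has decidable, indeed
`FP`, code recognition and decoding lemmas, as used in the landed S1b/S2 bricks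
`SymmetryBudgetWindowBarrier{ExtractBricks,ExtractBricks2,GraphBridge,HeaderBricks}.lean`); read off
`m`, `g = Nat.log 2 m`, the rows of vertex `0`; list `A` and `B` in increasing order; if `|A| ≠ |B|`
answer no; else extract the two induced adjacency matrices as codes `colGraphCode h G[A] 0`,
`colGraphCode h G[B] 0` (constant colouring) of length `O(g²) = O(log² |w|)` and answer
`[can(code A) = can(code B)]`, correct by completeness of canonical forms
(`babaiLuks1983_canonicalForm.complete`: equal images iff `ColIso`, iff `G[A] ≃g G[B]` for constant
colours; transport `G[A]` = `G.induce A` along the order-isomorphism `A ≃o Fin h`). Running time: the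
extraction is `FP`; `can` costs `2^{c√N}` on inputs of length `N ≤ (D log₂|w| + D)²`, i.e.
`2^{cD} |w|^{cD}` — polynomial (`TimeComputable`/`FTIME` composition as in `preimage_mem_P_of_mem_E`).
Why it might fail: only formalisation cost (TM plumbing ≈ 600–900 lines over the existing bricks).
Size: L (provable now). Sources: Babai–Luks 1983 (as above); Arora–Barak 2009 §1.3 (composition,
padding); this line. -/
theorem stub_twinIsoInP_of_canonicalForm :
    (∃ c : ℕ, ∃ can ∈ FTIME (fun N => 2 ^ (c * Nat.sqrt N)),
      (∀ (k : ℕ) (G : SimpleGraph (Fin k)) (col : Fin k → ℕ),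
          ∃ (G' : SimpleGraph (Fin k)) (col' : Fin k → ℕ),
            can (boolPair (encodingGraph.encode ⟨k, G⟩)
                  ((encodingFinVec Computability.encodingNatBool k).encode col)) =
                boolPair (encodingGraph.encode ⟨k, G'⟩)
                  ((encodingFinVec Computability.encodingNatBool k).encode col') ∧
              ∃ σ : G ≃g G', ∀ v : Fin k, col' (σ v) = col v) ∧
      ∀ (k : ℕ) (G₁ : SimpleGraph (Fin k)) (c₁ : Fin k → ℕ) (G₂ : SimpleGraph (Fin k))
        (c₂ : Fin k → ℕ), (∃ σ : G₁ ≃g G₂, ∀ v : Fin k, c₂ (σ v) = c₁ v) →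
          can (boolPair (encodingGraph.encode ⟨k, G₁⟩)
                ((encodingFinVec Computability.encodingNatBool k).encode c₁)) =
            can (boolPair (encodingGraph.encode ⟨k, G₂⟩)
                ((encodingFinVec Computability.encodingNatBool k).encode c₂))) →
    ∃ L ∈ Classes.P, ∀ (m : ℕ) (G : SimpleGraph (Fin m)),
      encodingGraph.encode ⟨m, G⟩ ∈ L ↔
        Nonempty
          (SimpleGraph.induce {u : Fin m | m ≤ (u : ℕ) + Nat.log 2 m ∧ ∃ h : 0 < m, G.Adj ⟨0, h⟩ u}
              G ≃g
            SimpleGraph.induce {u : Fin m | m ≤ (u : ℕ) + Nat.log 2 m ∧ ¬ ∃ h : 0 < m, G.Adj ⟨0, h⟩ u}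
              G) :=
  -- LANDED (stub-worker w-SP, p89186): `Theorems/SymmetryBudgetWindowBarrierStubTwinIsoInP.lean` (+ bricks p85656, p85700).
  _root_.Summit.PneNP.PneNP.Theorems.stub_twinIsoInP_of_canonicalForm

/-- **TwinIsoInP** (derived, no `sorry` of its own): S_P applied to S_BL. -/
theorem twinIsoInP :
    ∃ L ∈ Classes.P, ∀ (m : ℕ) (G : SimpleGraph (Fin m)),
      encodingGraph.encode ⟨m, G⟩ ∈ L ↔
        Nonempty
          (SimpleGraph.induce {u : Fin m | m ≤ (u : ℕ) + Nat.log 2 m ∧ ∃ h : 0 < m, G.Adj ⟨0, h⟩ u}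
              G ≃g
            SimpleGraph.induce {u : Fin m | m ≤ (u : ℕ) + Nat.log 2 m ∧ ¬ ∃ h : 0 < m, G.Adj ⟨0, h⟩ u}
              G) :=
  stub_twinIsoInP_of_canonicalForm stub_canonicalFormFTIME

/-- **S_H′ — HardToIdentify (HTI), the OPEN core of this line after the cycle-1 RESHAPE (hardest stub).**
For every rate `c`, for infinitely many `h`, SOME graph `H` on `Fin h` has no `Sym(Fin h)`-symmetric
`tcBasis`-circuit with at most `2^{ch}` gates computing the indicator `x ↦ [Gr x ≅ H]` of its isomorphism
class. It implies TwinIsoHard (`stub_twinIsoHard` below is now DERIVED from it through the landed bridge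
`Theorems.twinIsoHard_of_hardToIdentify`, p86449: plant `H` on the first free half) and is implied by the
old line's (★) CoreFooling (`Theorems.hardToIdentify_of_coreFooling`, p84987: an identifier of `G₁` separates
the fooling pair) — so it is the weakest open statement on file that closes the crux modulo Babai–Luks, with
no `P`/TM content and one explicit function per witness graph. Why plausibly true / why it might fail: exactly
as for TwinIsoHard — a witness family needs Weisfeiler–Leman dimension Ω̃(h/log h)·ω(1) AND robustness to O(1)
vertex-subset individualisations; every construction in print with super-polylog WL-dimension is a CFI-type
gadget lift and dies to one density-½ marking (Disproof F15; lead's kit j014750); the negation is TAME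
("every graph is identified by O(1)-set-IR + (h/log h)-WL"), equally open (AGGP MFCS 2014 §5, PSS CSL 2016,
LS LICS 2021, DW ToC 2025 §6–7). Calibration from above: identifiers of size `2^{O(h²)}` (DNF + Symmetrise)
and `h!·poly` always exist. Size: XL / open (crux-sized; promotion requested in
`Lines/bijection-gauge-twin-iso-PROMOTE-HTI.md`). Sources: doi:10.4086/toc.2025.v021a014 §6–7;
doi:10.1007/s00224-016-9692-2; arXiv:1705.03283; Grohe–Neuen 2021 (WL-dimension survey); Disproof.lean F7–F15. -/
theorem stub_hardToIdentify :
    ∀ c : ℕ, ∃ᶠ h in atTop, ∃ H : SimpleGraph (Fin h),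
      ¬ HasSymCircuit tcBasis Set.univ (2 ^ (c * h))
        (fun x : Fin h × Fin h → Bool =>
          decide (Nonempty ((SimpleGraph.fromRel fun u v => x (u, v) = true) ≃g H))) := by
  sorry

/-- **S_H — TwinIsoHard (registered; after the cycle-1 reshape DERIVED from `stub_hardToIdentify` by the landed
bridge `twinIsoHard_of_hardToIdentify`, p86449 — no `sorry` of its own).** Original description: For every polynomial `p`, for
infinitely many `m`, NO `Bud(m,⌊log₂ m⌋)`-symmetric `tcBasis`-circuit with at most `p m` gates
computes, on `m × m` Boolean matrices `x`, the bit `[Gr x [A] ≅ Gr x [B]]` (`A`/`B` = free vertices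
adjacent / not adjacent to the ordered vertex `0`; `Gr x = SimpleGraph.fromRel (x · · = true)`).
An EXPLICIT-FUNCTION symmetric lower bound in the window: weaker than (or equal to) the picked line's
(★) CoreFooling (`stub_twinIsoHard_of_coreFooling`), because here the inputs on which a small
symmetric circuit errs may depend on the circuit. Calibration: (i) upper bound `(g/2)!·3^g·poly(m)`
by gates indexed `(A, B, π)` (the route's `Symmetrise` restricted to the bijections `π : A → B`) —
inside `(2^g, g!)`, as the window requires; (ii) NOT killed by any affordable symmetric test in print:
colour refinement / fractional isomorphism and `(g/log g)`-dimensional Weisfeiler–Leman are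
window-cheap but incomplete (CFI halves), Ryser/inclusion–exclusion handles bijection-SUMS
(permanent, Dawar–Wilsenach ToC 2025 Thm 7.1) not an existential isomorphism, canonise-then-compare
needs a discretising vertex subset of the halves (idea `subset-canonisation-dichotomy`; Disproof F12
`not_windowBarrier_of_symCanonisation` is the formal version of this falsifier); (iii) it is FALSE at
budget `0` and whenever `g! ≤ poly` (Disproof F3′, `Symmetrise`), so the `Bud(m,⌊log₂ m⌋)` inside
`HasSymCircuit` is load-bearing, as for the crux. Equivalent in spirit to "graph isomorphism of two
`h`-vertex graphs has no `2^{O(h)}`-size `Sym(h) × Sym(h)`-symmetric threshold circuits", i.e. no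
choiceless moderately-exponential GI DECISION procedure (open both ways: Abu Zaid–Grädel–Grohe–Pakusa
MFCS 2014 §5; Disproof F8/F10). Why it might fail: a symmetric `2^{O(g)}` canoniser of `g`-vertex
graphs (TAME/SIC) refutes it together with the crux. Sources: doi:10.4086/toc.2025.v021a014 §6–7;
doi:10.1007/s00224-016-9692-2 Thm 1; arXiv:1705.03283; Disproof.lean F7–F12; TRIAGE-r1-2/3.
Size: XL / open (crux-sized: the hardest stub, where new mathematics is needed). -/
theorem stub_twinIsoHard :
    ∀ p : Polynomial ℕ, ∃ᶠ m in atTop,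
      ¬ HasSymCircuit tcBasis (pointStabiliserBudget m (Nat.log 2 m)) (p.eval m)
        (fun x : Fin m × Fin m → Bool => decide (Nonempty
          (SimpleGraph.induce {u : Fin m | m ≤ (u : ℕ) + Nat.log 2 m ∧ ∃ h : 0 < m, (SimpleGraph.fromRel fun u v => x (u, v) = true).Adj ⟨0, h⟩ u}
              (SimpleGraph.fromRel fun u v => x (u, v) = true) ≃g
            SimpleGraph.induce {u : Fin m | m ≤ (u : ℕ) + Nat.log 2 m ∧ ¬ ∃ h : 0 < m, (SimpleGraph.fromRel fun u v => x (u, v) = true).Adj ⟨0, h⟩ u}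
              (SimpleGraph.fromRel fun u v => x (u, v) = true)))) :=
  _root_.Summit.PneNP.PneNP.Theorems.twinIsoHard_of_hardToIdentify stub_hardToIdentify

/-- **S_T — (★) ⇒ TwinIsoHard (provable now; M).** Given `p`, take `d'` with `p(2^{g}) + 2 ≤ 2^{d' g}`
for large `g` (`CoreReduction.exists_pow_bound`) and apply (★) at `d = 2d'` to get, for infinitely many
`h`, non-isomorphic `G₁, G₂` on `Fin h` fooling all `Sym(h)`-symmetric circuits of size `≤ 2^{2d'h}`.
Put `m = 4^h` (`⌊log₂ m⌋ = 2h`; free part = the last `2h` indices, `A₀` = the first `h` of them, `B₀` =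
the last `h`). For a graph `G` on `Fin h` let `x_G` be the matrix with marker entries `(0, a) = 1`
(`a ∈ A₀`), the adjacency matrix of `G₁` on `A₀ × A₀`, that of `G` on `B₀ × B₀`, and `0` elsewhere; then
`A = A₀`, `B = B₀` and `TwinIso(x_G) = [G₁ ≅ G]`, so `x_{G₁} ↦ true`, `x_{G₂} ↦ false`. If a
`Bud(m,2h)`-symmetric `C` of size `≤ p m` computed twin isomorphism, HARD-WIRE every input outside
`B₀ × B₀` to its constant value in `x_G` (constants `∧₀ = 1`, `∨₀ = 0`, `HeaderHardwiring.exists_constPre`)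
and rename `B₀ × B₀` to `Fin h × Fin h` (`Relocation.exists_hardwire₂`; the wiring intertwines `ρ × ρ`,
`ρ = id ⊔ σ ∈ Bud` for `σ ∈ Sym(B₀)`, with `σ × σ`, and the constant pattern is `ρ × ρ`-invariant because
`ρ` fixes `0`, `A₀` and the ordered part pointwise — exactly `CoreReduction.exists_core_circuit` with a
second constant): the result is a `Sym(h)`-symmetric circuit `D` of size `≤ p(4^h) + 2 ≤ 2^{2d'h}` with
`D(adj G) = C(x_G)`, whence `D(adj G₁) = true ≠ false = D(adj G₂)` — contradicting (★). Why it might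
fail: it cannot mathematically; Lean cost is the index arithmetic of the three blocks (reuse
`CoreReduction.exists_plant/exists_extendPerm/iso_of_budIso` patterns). Sources:
`SymmetryBudgetWindowBarrierCoreReduction.lean`, `…Relocation.lean` (landed); TRIAGE-r1-2 (⇐ direction).
Size: M (provable now; ≈ 400 lines after `CoreReduction.lean`). -/
theorem stub_twinIsoHard_of_coreFooling :
    (∀ d : ℕ, ∃ᶠ g in atTop, ∃ G₁ G₂ : SimpleGraph (Fin g), ¬ Nonempty (G₁ ≃g G₂) ∧
      ∀ C : Circuit (Fin g × Fin g), C.IsOver tcBasis → C.size ≤ 2 ^ (d * g) →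
        C.IsSymmetricUnder Set.univ →
          C.eval (fun p : Fin g × Fin g => decide (G₁.Adj p.1 p.2)) =
            C.eval (fun p : Fin g × Fin g => decide (G₂.Adj p.1 p.2))) →
    ∀ p : Polynomial ℕ, ∃ᶠ m in atTop,
      ¬ HasSymCircuit tcBasis (pointStabiliserBudget m (Nat.log 2 m)) (p.eval m)
        (fun x : Fin m × Fin m → Bool => decide (Nonempty
          (SimpleGraph.induce {u : Fin m | m ≤ (u : ℕ) + Nat.log 2 m ∧ ∃ h : 0 < m, (SimpleGraph.fromRel fun u v => x (u, v) = true).Adj ⟨0, h⟩ u}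
              (SimpleGraph.fromRel fun u v => x (u, v) = true) ≃g
            SimpleGraph.induce {u : Fin m | m ≤ (u : ℕ) + Nat.log 2 m ∧ ¬ ∃ h : 0 < m, (SimpleGraph.fromRel fun u v => x (u, v) = true).Adj ⟨0, h⟩ u}
              (SimpleGraph.fromRel fun u v => x (u, v) = true)))) :=
  -- LANDED (stub-worker w-ST, p85069): `Theorems/SymmetryBudgetWindowBarrierStubTwinIsoHardOfCoreFooling.lean`.
  _root_.Summit.PneNP.PneNP.Theorems.stub_twinIsoHard_of_coreFooling

/-! ## Composition (no `sorry` below this line) -/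

/-- Freeness of an index (`m ≤ u + g`: `u` is one of the last `g` points) is preserved by every
`ρ ∈ Bud(m, g)` (which fixes the other points). [folklore] -/
theorem free_apply_iff {m g : ℕ} {ρ : Equiv.Perm (Fin m)} (hρ : ρ ∈ pointStabiliserBudget m g)
    (u : Fin m) : m ≤ ((ρ u : Fin m) : ℕ) + g ↔ m ≤ (u : ℕ) + g := by
  rw [mem_pointStabiliserBudget_iff] at hρ
  constructor
  · intro h
    by_contra hu
    have h1 : ρ u = u := hρ u (by omega)
    rw [h1] at h
    omega
  · intro h
    by_contra hu
    have h1 : ρ (ρ u) = ρ u := hρ (ρ u) (by omega)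
    have h2 : ρ u = u := ρ.injective h1
    rw [h2] at hu
    omega

/-- `Bud(m, ⌊log₂ m⌋)` fixes the marker vertex `0` (because `⌊log₂ m⌋ < m`). [folklore] -/
theorem apply_zero {m : ℕ} {ρ : Equiv.Perm (Fin m)}
    (hρ : ρ ∈ pointStabiliserBudget m (Nat.log 2 m)) (h : 0 < m) :
    ρ ⟨0, h⟩ = ⟨0, h⟩ :=
  hρ ⟨0, h⟩ (by
    show 0 + Nat.log 2 m < m
    rw [zero_add]
    exact Nat.log_lt_self 2 (by omega))

/-- `ρ` is an isomorphism from the graph of the relabelled matrix `x ∘ (ρ × ρ)` onto the graph of `x`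
(the route's `Gr`; cf. `Disproof.grRelabelIso`). [folklore] -/
def relabelIso {m : ℕ} (ρ : Equiv.Perm (Fin m)) (x : Fin m × Fin m → Bool) :
    (SimpleGraph.fromRel fun u v => x (ρ u, ρ v) = true) ≃g
      (SimpleGraph.fromRel fun u v => x (u, v) = true) where
  toEquiv := ρ
  map_rel_iff' := by
    intro a b
    simp [SimpleGraph.fromRel_adj, ρ.injective.ne_iff]

/-- **`Bud`-invariance of twin isomorphism (Disproof F3: the invariance clause is load-bearing — here
it is a THEOREM, for every `m`).** For `ρ ∈ Bud(m,⌊log₂ m⌋)`, the graph of `x ∘ (ρ × ρ)` has the twin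
isomorphism property iff the graph of `x` does: `ρ` fixes `0`, preserves freeness, and is an
isomorphism of the two graphs, so it carries the marked halves onto the marked halves and restricts to
isomorphisms of the induced subgraphs (`SimpleGraph.Iso.induce`). -/
theorem twinIso_relabel_iff {m : ℕ} {ρ : Equiv.Perm (Fin m)}
    (hρ : ρ ∈ pointStabiliserBudget m (Nat.log 2 m)) (x : Fin m × Fin m → Bool) :
    (Nonempty
      (SimpleGraph.induce {u : Fin m | m ≤ (u : ℕ) + Nat.log 2 m ∧ ∃ h : 0 < m, (SimpleGraph.fromRel fun u v => x (ρ u, ρ v) = true).Adj ⟨0, h⟩ u}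
          (SimpleGraph.fromRel fun u v => x (ρ u, ρ v) = true) ≃g
        SimpleGraph.induce {u : Fin m | m ≤ (u : ℕ) + Nat.log 2 m ∧ ¬ ∃ h : 0 < m, (SimpleGraph.fromRel fun u v => x (ρ u, ρ v) = true).Adj ⟨0, h⟩ u}
          (SimpleGraph.fromRel fun u v => x (ρ u, ρ v) = true))) ↔
      (Nonempty
      (SimpleGraph.induce {u : Fin m | m ≤ (u : ℕ) + Nat.log 2 m ∧ ∃ h : 0 < m, (SimpleGraph.fromRel fun u v => x (u, v) = true).Adj ⟨0, h⟩ u}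
          (SimpleGraph.fromRel fun u v => x (u, v) = true) ≃g
        SimpleGraph.induce {u : Fin m | m ≤ (u : ℕ) + Nat.log 2 m ∧ ¬ ∃ h : 0 < m, (SimpleGraph.fromRel fun u v => x (u, v) = true).Adj ⟨0, h⟩ u}
          (SimpleGraph.fromRel fun u v => x (u, v) = true))) := by
  set G' : SimpleGraph (Fin m) := SimpleGraph.fromRel fun u v => x (ρ u, ρ v) = true with hG'
  set G : SimpleGraph (Fin m) := SimpleGraph.fromRel fun u v => x (u, v) = true with hG
  let φ : G' ≃g G := relabelIso ρ x
  have hφ : ∀ u, φ u = ρ u := fun u => rfl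
  -- marker adjacency is transported by `ρ` (which fixes `0`)
  have hmark : ∀ u : Fin m, (∃ h : 0 < m, G'.Adj ⟨0, h⟩ u) ↔ ∃ h : 0 < m, G.Adj ⟨0, h⟩ (ρ u) := by
    intro u
    constructor
    · rintro ⟨h, hu⟩
      refine ⟨h, ?_⟩
      have h2 : G.Adj (φ ⟨0, h⟩) (φ u) := (φ.map_rel_iff).2 hu
      rwa [hφ, hφ, apply_zero hρ h] at h2
    · rintro ⟨h, hu⟩
      refine ⟨h, (φ.map_rel_iff).1 ?_⟩
      rw [hφ, hφ, apply_zero hρ h]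
      exact hu
  -- the two marked halves are carried onto the two marked halves
  have hA : Set.BijOn φ {u : Fin m | m ≤ (u : ℕ) + Nat.log 2 m ∧ ∃ h : 0 < m, G'.Adj ⟨0, h⟩ u}
      {u : Fin m | m ≤ (u : ℕ) + Nat.log 2 m ∧ ∃ h : 0 < m, G.Adj ⟨0, h⟩ u} := by
    refine ⟨?_, φ.injective.injOn, ?_⟩
    · intro u hu
      simp only [Set.mem_setOf_eq] at hu ⊢
      rw [hφ]
      exact ⟨(free_apply_iff hρ u).2 hu.1, (hmark u).1 hu.2⟩
    · intro v hv
      simp only [Set.mem_setOf_eq] at hv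
      refine ⟨ρ.symm v, ?_, ?_⟩
      · simp only [Set.mem_setOf_eq]
        have h1 := free_apply_iff hρ (ρ.symm v)
        have h2 := hmark (ρ.symm v)
        rw [Equiv.apply_symm_apply] at h1 h2
        exact ⟨h1.1 hv.1, h2.2 hv.2⟩
      · rw [hφ, Equiv.apply_symm_apply]
  have hB : Set.BijOn φ {u : Fin m | m ≤ (u : ℕ) + Nat.log 2 m ∧ ¬ ∃ h : 0 < m, G'.Adj ⟨0, h⟩ u}
      {u : Fin m | m ≤ (u : ℕ) + Nat.log 2 m ∧ ¬ ∃ h : 0 < m, G.Adj ⟨0, h⟩ u} := by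
    refine ⟨?_, φ.injective.injOn, ?_⟩
    · intro u hu
      simp only [Set.mem_setOf_eq] at hu ⊢
      rw [hφ]
      exact ⟨(free_apply_iff hρ u).2 hu.1, (hmark u).not.1 hu.2⟩
    · intro v hv
      simp only [Set.mem_setOf_eq] at hv
      refine ⟨ρ.symm v, ?_, ?_⟩
      · simp only [Set.mem_setOf_eq]
        have h1 := free_apply_iff hρ (ρ.symm v)
        have h2 := hmark (ρ.symm v)
        rw [Equiv.apply_symm_apply] at h1 h2
        exact ⟨h1.1 hv.1, h2.not.2 hv.2⟩
      · rw [hφ, Equiv.apply_symm_apply]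
  constructor
  · rintro ⟨f⟩
    exact ⟨((φ.induce hA).symm.trans f).trans (φ.induce hB)⟩
  · rintro ⟨f⟩
    exact ⟨(φ.induce hA).trans (f.trans (φ.induce hB).symm)⟩

/-- **`TwinIsoInP → TwinIsoHard → WindowBarrier`**, the crux written over the landed vocabulary
(`HasSymCircuit tcBasis`, `pointStabiliserBudget`; definitionally the route's inline `HasSym`/`Bud`).
Take `L` from `TwinIsoInP`: its slices are `Bud`-invariant for EVERY `m` by `twinIso_relabel_iff`, and
the slice function IS the twin-isomorphism function (pointwise `decide_eq_decide`), so `TwinIsoHard`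
is the hardness clause verbatim. -/
theorem windowBarrier_of_twinIso
    (hP : ∃ L ∈ Classes.P, ∀ (m : ℕ) (G : SimpleGraph (Fin m)),
      encodingGraph.encode ⟨m, G⟩ ∈ L ↔
        Nonempty
          (SimpleGraph.induce {u : Fin m | m ≤ (u : ℕ) + Nat.log 2 m ∧ ∃ h : 0 < m, G.Adj ⟨0, h⟩ u}
              G ≃g
            SimpleGraph.induce {u : Fin m | m ≤ (u : ℕ) + Nat.log 2 m ∧ ¬ ∃ h : 0 < m, G.Adj ⟨0, h⟩ u}
              G))
    (hH : ∀ p : Polynomial ℕ, ∃ᶠ m in atTop,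
      ¬ HasSymCircuit tcBasis (pointStabiliserBudget m (Nat.log 2 m)) (p.eval m)
        (fun x : Fin m × Fin m → Bool => decide (Nonempty
          (SimpleGraph.induce {u : Fin m | m ≤ (u : ℕ) + Nat.log 2 m ∧ ∃ h : 0 < m, (SimpleGraph.fromRel fun u v => x (u, v) = true).Adj ⟨0, h⟩ u}
              (SimpleGraph.fromRel fun u v => x (u, v) = true) ≃g
            SimpleGraph.induce {u : Fin m | m ≤ (u : ℕ) + Nat.log 2 m ∧ ¬ ∃ h : 0 < m, (SimpleGraph.fromRel fun u v => x (u, v) = true).Adj ⟨0, h⟩ u}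
              (SimpleGraph.fromRel fun u v => x (u, v) = true))))) :
    ∃ L ∈ Classes.P,
      (∀ m : ℕ, ∀ ρ ∈ pointStabiliserBudget m (Nat.log 2 m), ∀ x : Fin m × Fin m → Bool,
        encodingGraph.encode ⟨m, SimpleGraph.fromRel fun u v => x (ρ u, ρ v) = true⟩ ∈ L ↔
          encodingGraph.encode ⟨m, SimpleGraph.fromRel fun u v => x (u, v) = true⟩ ∈ L) ∧
      ∀ p : Polynomial ℕ, ∃ᶠ m in atTop,
        ¬ HasSymCircuit tcBasis (pointStabiliserBudget m (Nat.log 2 m)) (p.eval m)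
            (fun x : Fin m × Fin m → Bool =>
              decide (encodingGraph.encode ⟨m, SimpleGraph.fromRel fun u v => x (u, v) = true⟩ ∈ L)) := by
  obtain ⟨L, hLP, hL⟩ := hP
  refine ⟨L, hLP, ?_, ?_⟩
  · intro m ρ hρ x
    exact (hL m _).trans ((twinIso_relabel_iff hρ x).trans (hL m _).symm)
  · intro p
    refine (hH p).mono fun m hm => ?_
    have hfun : (fun x : Fin m × Fin m → Bool =>
        decide (encodingGraph.encode ⟨m, SimpleGraph.fromRel fun u v => x (u, v) = true⟩ ∈ L)) =
        (fun x : Fin m × Fin m → Bool => decide (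
      Nonempty
      (SimpleGraph.induce {u : Fin m | m ≤ (u : ℕ) + Nat.log 2 m ∧ ∃ h : 0 < m, (SimpleGraph.fromRel fun u v => x (u, v) = true).Adj ⟨0, h⟩ u}
          (SimpleGraph.fromRel fun u v => x (u, v) = true) ≃g
        SimpleGraph.induce {u : Fin m | m ≤ (u : ℕ) + Nat.log 2 m ∧ ¬ ∃ h : 0 < m, (SimpleGraph.fromRel fun u v => x (u, v) = true).Adj ⟨0, h⟩ u}
          (SimpleGraph.fromRel fun u v => x (u, v) = true)))) := by
      funext x
      exact decide_eq_decide.2 (hL m _)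
    rw [hfun]
    exact hm

/-- **Skeleton theorem**: the crux `SymmetryBudget.WindowBarrier`, concluded BY NAME from the stubs
`stub_canonicalFormFTIME`, `stub_twinIsoInP_of_canonicalForm`, `stub_twinIsoHard` (the route decl's
`let Sym … HasSym … Bud … Gr …` prelude is verbatim `Circuit.IsSymmetricUnder`, `HasSymCircuit tcBasis`,
`pointStabiliserBudget`, `SimpleGraph.fromRel fun u v => x (u, v) = true`, so `windowBarrier_of_twinIso`
closes it by definitional unfolding). The (★)-sub-route is `windowBarrier_restated_of_coreFooling`. -/
theorem WindowBarrier_of : Summit.PneNP.PneNP.Theses.SymmetryBudget.WindowBarrier := by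
  have H := windowBarrier_of_twinIso twinIsoInP stub_twinIsoHard
  exact H

/-- **The (★)-sub-route, recorded**: the same composition with `stub_twinIsoHard` replaced by
`stub_twinIsoHard_of_coreFooling` applied to the picked line's open core (★) CoreFooling (stated here
as a HYPOTHESIS, verbatim the hypothesis of the landed `Summit.PneNP.PneNP.Theorems.stub_coreReduction`;
it is the lead's stub S4-core / proposed item, not re-registered by this line). It concludes the
restated crux, so that exactly ONE theorem of this file (`WindowBarrier_of`) concludes the crux by name. -/
theorem windowBarrier_restated_of_coreFooling
    (hcore : ∀ d : ℕ, ∃ᶠ g in atTop, ∃ G₁ G₂ : SimpleGraph (Fin g), ¬ Nonempty (G₁ ≃g G₂) ∧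
      ∀ C : Circuit (Fin g × Fin g), C.IsOver tcBasis → C.size ≤ 2 ^ (d * g) →
        C.IsSymmetricUnder Set.univ →
          C.eval (fun p : Fin g × Fin g => decide (G₁.Adj p.1 p.2)) =
            C.eval (fun p : Fin g × Fin g => decide (G₂.Adj p.1 p.2))) :
    ∃ L ∈ Classes.P,
      (∀ m : ℕ, ∀ ρ ∈ pointStabiliserBudget m (Nat.log 2 m), ∀ x : Fin m × Fin m → Bool,
        encodingGraph.encode ⟨m, SimpleGraph.fromRel fun u v => x (ρ u, ρ v) = true⟩ ∈ L ↔
          encodingGraph.encode ⟨m, SimpleGraph.fromRel fun u v => x (u, v) = true⟩ ∈ L) ∧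
      ∀ p : Polynomial ℕ, ∃ᶠ m in atTop,
        ¬ HasSymCircuit tcBasis (pointStabiliserBudget m (Nat.log 2 m)) (p.eval m)
            (fun x : Fin m × Fin m → Bool =>
              decide (encodingGraph.encode ⟨m, SimpleGraph.fromRel fun u v => x (u, v) = true⟩ ∈ L)) :=
  windowBarrier_of_twinIso twinIsoInP (stub_twinIsoHard_of_coreFooling hcore)

end Summit.PneNP.PneNP.Cruxes.WindowBarrier.BijectionGaugeTwinIso
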